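import Summits.ABC.StewartYu.PadicG3TwoFunctions
import HarnessLib

/-!
# Cell abc-stewartyu, Gen-3 frame at `p = 2` (crux `Y07Two`, stmt-ABC-19659), level-0 combinatorics: the BOX OF
# UNKNOWNS `(ℓ₀, (u, u_θ))` and the EQUATION SET `{(x, τ) : |x| ≤ N, |τ| < T}` as finite sets, with their counts

`Summits/ABC/StewartYu/PadicG3TwoBoxes.lean` — cell `abc-stewartyu` (HOME `run/shared/lean/pub/abc-stewartyu/`),
route `PadicPrimesKummerThird`, seat p3 (g5), F-two LEAD.  Definitions (two `Finset`s) and theorems; the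
combinatorial inputs `B` and `E` of `PadicG3TwoSlabSiegel.exists_g3_slab_siegel` (level 0 of p5-g3's
`PadicG3TwoMain.SiegelTwo`):

* `famBox L₀ Dbox Dθ : Finset (ℕ × ((Fin d → ℤ) × ℤ))` — the unknowns `(ℓ₀, (u, u_θ))` with `ℓ₀ ≤ L₀`,
  `|uⱼ| ≤ Dboxⱼ`, `|u_θ| ≤ Dθ`; `mem_famBox`; `card_famBox = (L₀+1)·∏(2Dboxⱼ+1)·(2Dθ+1)`;
* `eqSet d N T : Finset (ℤ × Tau d)` — the equations `(x, τ)` with `|x| ≤ N`, `tauNorm τ < T`; `mem_eqSet`;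
  `card_eqSet_le : #eqSet ≤ (2N+1)·T^{d+1}`; `eqSet_nonempty` (`T ≥ 1`);
* `vanish_of_eqSet` — reading `∀ e ∈ eqSet, g3φ e.2 e.1 = 0` as the level-0 vanishing statement.

WHAT THIS IS NOT: no Siegel step (that is `exists_g3_slab_siegel`); no crux moves.

References: K. Yu, Acta Math. 211 (2013), §4 (4.1)–(4.3); Yu. V. Nesterenko, LNM 1819 (2003), §3.4 (3.12).
-/

noncomputable section

open Finset
open Literature.NumberTheory.Transcendental
open Literature.NumberTheory.Transcendental.CW77.Setup (Tau tauNorm)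

namespace Summit.ABC.StewartYu.G3Boxes

/-! ### The box of unknowns -/

/-- **The box of unknowns** `(ℓ₀, (u, u_θ))`: `ℓ₀ ≤ L₀`, `|uⱼ| ≤ Dboxⱼ`, `|u_θ| ≤ D_θ`.
[cite: Yu2013, §4 (4.1); shape only] -/
def famBox {d : ℕ} (L₀ : ℕ) (Dbox : Fin d → ℕ) (Dθ : ℕ) : Finset (ℕ × ((Fin d → ℤ) × ℤ)) :=
  (range (L₀ + 1)) ×ˢ ((Fintype.piFinset fun j => Icc (-(Dbox j : ℤ)) (Dbox j)) ×ˢ Icc (-(Dθ : ℤ)) Dθ)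

/-- Membership in the box. [folklore] -/
theorem mem_famBox {d : ℕ} {L₀ : ℕ} {Dbox : Fin d → ℕ} {Dθ : ℕ} {i : ℕ × ((Fin d → ℤ) × ℤ)} :
    i ∈ famBox L₀ Dbox Dθ ↔ i.1 ≤ L₀ ∧ (∀ j, |i.2.1 j| ≤ (Dbox j : ℤ)) ∧ |i.2.2| ≤ (Dθ : ℤ) := by
  unfold famBox
  rw [mem_product, mem_product, mem_range, Fintype.mem_piFinset, mem_Icc, Nat.lt_succ_iff, abs_le]
  simp only [mem_Icc, abs_le]

/-- The number of unknowns: `(L₀+1)·∏ⱼ(2Dboxⱼ+1)·(2D_θ+1)`. [cite: Yu2013, §4 (4.3); shape only] -/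
theorem card_famBox {d : ℕ} (L₀ : ℕ) (Dbox : Fin d → ℕ) (Dθ : ℕ) :
    (famBox L₀ Dbox Dθ).card = (L₀ + 1) * ((∏ j, (2 * Dbox j + 1)) * (2 * Dθ + 1)) := by
  unfold famBox
  rw [card_product, card_product, card_range, Fintype.card_piFinset]
  congr 2
  · refine Finset.prod_congr rfl fun j _ => ?_
    rw [Int.card_Icc]; omega
  · rw [Int.card_Icc]; omega

/-! ### The equation set -/

/-- **The equations of level `0`**: `(x, τ)` with `|x| ≤ N` and `tauNorm τ < T`. [cite: Yu2013, §4 (4.2); shape only] -/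
def eqSet (d N T : ℕ) : Finset (ℤ × Tau d) :=
  (Icc (-(N : ℤ)) N ×ˢ ((range T) ×ˢ Fintype.piFinset fun _ : Fin d => range T)).filter
    fun e => tauNorm e.2 < T

/-- Membership in the equation set. [folklore] -/
theorem mem_eqSet {d N T : ℕ} {e : ℤ × Tau d} : e ∈ eqSet d N T ↔ |e.1| ≤ (N : ℤ) ∧ tauNorm e.2 < T := by
  unfold eqSet
  rw [mem_filter, mem_product, mem_product, mem_Icc, mem_range, Fintype.mem_piFinset, abs_le]
  constructor
  · rintro ⟨⟨hx, -, -⟩, hτ⟩; exact ⟨hx, hτ⟩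
  · rintro ⟨hx, hτ⟩
    refine ⟨⟨hx, ?_, fun j => mem_range.mpr ?_⟩, hτ⟩
    · unfold tauNorm at hτ; omega
    · unfold tauNorm at hτ
      have : e.2.2 j ≤ ∑ k, e.2.2 k := Finset.single_le_sum (fun _ _ => Nat.zero_le _) (mem_univ j)
      omega

/-- The number of equations: `#eqSet ≤ (2N+1)·T^{d+1}`. [cite: Yu2013, §4 (4.3); shape only] -/
theorem card_eqSet_le (d N T : ℕ) : (eqSet d N T).card ≤ (2 * N + 1) * T ^ (d + 1) := by
  unfold eqSet
  refine (card_filter_le _ _).trans ?_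
  rw [card_product, card_product, card_range, Fintype.card_piFinset, prod_const, card_univ,
    Fintype.card_fin, card_range, Int.card_Icc]
  have : ((N : ℤ) + 1 - -(N : ℤ)).toNat = 2 * N + 1 := by omega
  rw [this, pow_succ']

/-- The equation set is nonempty as soon as `T ≥ 1` (it contains `(0, 0)`). [folklore] -/
theorem eqSet_nonempty (d N : ℕ) {T : ℕ} (hT : 1 ≤ T) : (eqSet d N T).Nonempty := by
  refine ⟨((0 : ℤ), ((0 : ℕ), fun _ => (0 : ℕ))), ?_⟩
  rw [mem_eqSet]
  refine ⟨by simp, ?_⟩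
  unfold tauNorm
  simp only [Finset.sum_const_zero, add_zero]
  omega

/-- **Reading the Siegel output as the level-0 vanishing**: if `g3φ e.2 e.1 = 0` for all `e ∈ eqSet d N T`, then
`g3φ τ x = 0` for all `|x| ≤ N`, `tauNorm τ < T`. [folklore] -/
theorem vanish_of_eqSet (S : TwoSetup) {ι : Type*} (R : ι → Polynomial ℚ) (u : ι → Fin S.d → ℤ)
    (uθ : ι → ℤ) (B : Finset ι) (p : ι → ℤ) {N T : ℕ}
    (h : ∀ e ∈ eqSet S.d N T, S.g3φ R u uθ B p e.2 e.1 = 0) :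
    ∀ x : ℤ, |x| ≤ (N : ℤ) → ∀ τ : Tau S.d, tauNorm τ < T → S.g3φ R u uθ B p τ x = 0 :=
  fun x hx τ hτ => h (x, τ) (mem_eqSet.mpr ⟨hx, hτ⟩)

/-! ### The Siegel count for the box and the equation set -/

/-- **The count** `2·2^m·#eqSet ≤ #famBox` from the scalar inequality
`2·2^m·(2N+1)·T^{d+1} ≤ (L₀+1)·∏(2Dboxⱼ+1)·(2D_θ+1)` (the record's Siegel line). [cite: Yu2013, (4.3); shape only] -/
theorem siegel_count {d : ℕ} (m L₀ : ℕ) (Dbox : Fin d → ℕ) (Dθ N T : ℕ)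
    (h : 2 * 2 ^ m * ((2 * N + 1) * T ^ (d + 1)) ≤ (L₀ + 1) * ((∏ j, (2 * Dbox j + 1)) * (2 * Dθ + 1))) :
    2 * 2 ^ m * (eqSet d N T).card ≤ (famBox L₀ Dbox Dθ).card := by
  rw [card_famBox]
  exact (Nat.mul_le_mul_left _ (card_eqSet_le d N T)).trans h

end Summit.ABC.StewartYu.G3Boxes

end
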